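import Summits.ResolutionOfSingularities.ResolutionOfSingularities.Theorems.PurelyInseparableDim4SupportVirtualStepRank
import Summits.ResolutionOfSingularities.ResolutionOfSingularities.Theorems.PurelyInseparableDim4ResConePairVirtualChain
import Summits.ResolutionOfSingularities.ResolutionOfSingularities.Theorems.PurelyInseparableDim4ResConePowerChain
import Summits.ResolutionOfSingularities.ResolutionOfSingularities.Theorems.PurelyInseparableDim4TschirnhausChain
import HarnessLib
import HarnessLib.Audit.Tags

/-!
# Purely inseparable four-folds — THE SUPPORT-CONFINED RE-PRESENTATION FOR ANY POLAR-KERNEL RANK, and the POWER-CONE dictionary: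
# «WLOG the form-carrying free letter stays free for ever» (K2(p) lane, B rows = power cones `e_G = 3`; every prime, every shade;
# seat res-dim4-p-1 g6)

[OURS · counted 0 · cell `res-dim4-pi` · K2(p) lane (holder res-dim4-p-12 g5: «K2(p) ⟺ the power-cone tails TAIL(p, d, 3); the power-cone half
has NO mechanism for its heavy classes», bus 2026-08-29 11:01Z) · seat res-dim4-p-1 g6.]  Nothing here proves any TAIL(p, d, 3), K2(p),
`NoIsolatedTrap p p`, the Cossart–Jannsen–Saito / Cossart–Piltant theorems or resolution of singularities in dimension ≥ 4 / characteristic `p`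
— NOT proved; a STRUCTURE statement (an honest re-presentation exists), not a kill.  AI kernel work, weaker than expert review.

THE OBSERVATION.  res-dim4-typ-1 g4's support-confined virtual step (`SwapTransport.support_virtual_step`, p709996) uses the polar-kernel rank
`e_G = 2` only in its STATEMENT: every transport lemma it calls is rank-free, and TT_S («no non-zero kernel vector vanishes on `S`») both picks the
virtual chart and transports for any rank.  `…SupportVirtualStepRank` is that file with `2 ↦ e_G`.  On top of it:
* §1 **`support_virtual_chain_rank (p) (S) (eG)`** — the abstract `S`-confined virtual chain for any rank (my `support_virtual_chain`, p711054,
  with `2 ↦ eG`).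
* §2 **`support_representation_of_TT (p) (eG)`** — for a witnessed isolated above-floor `Step0 p` chain with `x^{r₀} ∣ F₀`, constant shade `d` and
  `finrank Vtx ≡ eG` from `k₀`, and an ENTRY time `kₑ ≥ k₀` at which the state is clean, its boundary lies inside `S` and TT_S holds, there is an
  honest partner `c′` (`c′ 0 = c kₑ`, same shade, rank `eG`, weights = real weights renamed) CONFINED to `S` (charts in `S`, no boundary letter off
  `S`, TT_S at every time).  For `eG = 2` the entry came for free from FT + `tt_of_satellite` (p711054 §A4); for other ranks it is a hypothesis.
* §3 THE POWER-CONE DICTIONARY (`eG = 3`, `Vtx = ker ℓ`, `g = a·ℓ^d`, `chain_powerCone_package`): for `S = univ ∖ {φ}`, **TT_S ⟺ `ℓ φ ≠ 0`**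
  (`tt_erase_iff_apply_ne_zero`) — «the letter off `S` CARRIES the form»; and **`powerCone_freeCarrier_representation (p)`**: if at some late time
  `kₑ ≥ k₀ + 1` a letter `φ` is NOT a boundary letter and CARRIES the form (`ℓ_{kₑ} φ ≠ 0`), the power-cone tail has an honest partner in which `φ`
  is NEVER charted and NEVER a boundary letter at any time (translated freely) and carries the partner's form at every time — the standing
  hypothesis of K25 `no_light_triple_tail` («fourth letter free and carrying L») / the T-SECTOR of K24a, now a re-presentation FACT for all weights:
  the T-sector of every B row is a THREE-LETTER game with one passive form-carrying letter.  The L-SECTOR (the form vanishes on every non-boundary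
  letter at every late clean time) is the complement and is not touched here.
[cite: CossartJannsenSaito2020, Thm. 3.10(4), Thm. 3.14] [cite: Hauser2010, §§F–G (chart expressions of a point blowup; cleaning)]
[cite: HauserPerlega2019PRIMS, §2 (transform D′ of D)]
bears_on: LADDER-RESOLUTION:D157-DOOR2 (res-dim4-pi · K2(p) = `RidgeBudget.NoAboveFloorTrap p p` · B rows · support-confined re-presentation for any
rank; power cones: free form-carrier normal form).  Supports stmt-ResolutionOfSingularities-16155 (helper).
-/

set_option linter.dupNamespace false -- mandated namespace of this single-conjunct summit

noncomputable section

namespace Summit.ResolutionOfSingularities.ResolutionOfSingularities.Theorems.PIDim4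

namespace ResCone

open MvPolynomial Finset
open Literature.AlgebraicGeometry.Resolution
open Literature.AlgebraicGeometry.Resolution.CentreBlowup
open Literature.AlgebraicGeometry.Resolution.Hauser2010
open Literature.AlgebraicGeometry.Resolution.HauserPerlega2019

variable {K : Type} [Field K] [DecidableEq K] (p : ℕ)

/-! ## §1 The abstract `S`-confined virtual chain, any rank -/

/-- **THE ABSTRACT `S`-CONFINED VIRTUAL CHAIN, every prime `p`, every shade `d`, every letter set `S`, every kernel rank `eG`** (my
`support_virtual_chain` p711054 with `2 ↦ eG`; `Nat.rec` + `Classical.epsilon`). [OURS · conditional on `hvstep`]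
[cite: CossartJannsenSaito2020, Thm. 3.14] [cite: Hauser2010, §§F–G (chart expressions of a point blowup; cleaning)] -/
theorem support_virtual_chain_rank (S : Finset (Fin 4)) (eG : ℕ) {d : ℕ} {Inv : ℕ → State K → Prop} {B₀ : State K}
    (hentry : Inv 0 B₀)
    (hshape : ∀ t B, Inv t B → IsIsolated p B.F ∧ ordZero B.F = ((B.r.degree + d : ℕ) : ℕ∞) ∧ p < B.r.degree + d ∧
      Module.finrank K (resVertex B) = eG ∧ (∀ i, i ∉ S → B.r i = 0) ∧ (∀ e ∈ B.F.support, B.r ≤ e))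
    (hvstep : ∀ t B, Inv t B → ∃ (ℓ : Fin 4) (β : Fin 4 → K), ℓ ∈ S ∧ β ℓ = 0 ∧
      Inv (t + 1) (CentreBlowup.step p Finset.univ ℓ β B)) :
    ∃ (c' : ℕ → State K) (j' : ℕ → Fin 4) (b' : ℕ → Fin 4 → K), c' 0 = B₀ ∧ (∀ t, Inv t (c' t)) ∧
      (∀ t, IsIsolated p (c' t).F ∧ Step0 p (c' t) (c' (t + 1))) ∧ FreeTail.IsWitnessedChain p c' j' b' ∧
      (∀ e ∈ (c' 0).F.support, (c' 0).r ≤ e) ∧ (∀ t, ordZero (c' t).F ≠ p) ∧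
      (∀ t, 0 ≤ t → (c' t).shade = (d : ℕ∞)) ∧ (∀ t, 0 ≤ t → Module.finrank K (resVertex (c' t)) = eG) ∧
      (∀ t, j' t ∈ S) ∧ (∀ t, ∀ i, i ∉ S → (c' t).r i = 0) := by
  obtain ⟨Q, hQ⟩ : ∃ Q : ℕ → State K → Fin 4 × (Fin 4 → K) → Prop,
      ∀ t B x, Q t B x ↔ (x.1 ∈ S ∧ x.2 x.1 = 0 ∧ Inv (t + 1) (CentreBlowup.step p Finset.univ x.1 x.2 B)) :=
    ⟨_, fun _ _ _ => Iff.rfl⟩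
  obtain ⟨sq, hd0, hds⟩ : ∃ sq : ℕ → State K, sq 0 = B₀ ∧
      ∀ t, sq (t + 1) = CentreBlowup.step p Finset.univ (Classical.epsilon (Q t (sq t))).1
        (Classical.epsilon (Q t (sq t))).2 (sq t) :=
    ⟨fun t => Nat.rec B₀ (fun t dt => CentreBlowup.step p Finset.univ (Classical.epsilon (Q t dt)).1
      (Classical.epsilon (Q t dt)).2 dt) t, rfl, fun _ => rfl⟩
  have hINV : ∀ t, Inv t (sq t) := by
    intro t
    induction t with
    | zero => rw [hd0]; exact hentry
    | succ t ih =>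
      have hex : ∃ x, Q t (sq t) x := by
        obtain ⟨ℓ, β, hℓ, hβ, h⟩ := hvstep t (sq t) ih
        exact ⟨(ℓ, β), (hQ t (sq t) (ℓ, β)).mpr ⟨hℓ, hβ, h⟩⟩
      obtain ⟨-, -, h⟩ := (hQ t (sq t) _).mp (Classical.epsilon_spec hex)
      rw [hds t]
      exact h
  have hspec : ∀ t, Q t (sq t) (Classical.epsilon (Q t (sq t))) := fun t => by
    have hex : ∃ x, Q t (sq t) x := by
      obtain ⟨ℓ, β, hℓ, hβ, h⟩ := hvstep t (sq t) (hINV t)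
      exact ⟨(ℓ, β), (hQ t (sq t) (ℓ, β)).mpr ⟨hℓ, hβ, h⟩⟩
    exact Classical.epsilon_spec hex
  have hℓ : ∀ t, (Classical.epsilon (Q t (sq t))).1 ∈ S := fun t => ((hQ t (sq t) _).mp (hspec t)).1
  have hβℓ : ∀ t, (Classical.epsilon (Q t (sq t))).2 (Classical.epsilon (Q t (sq t))).1 = 0 := fun t =>
    ((hQ t (sq t) _).mp (hspec t)).2.1
  have hisoV : ∀ t, IsIsolated p (sq t).F := fun t => (hshape t (sq t) (hINV t)).1
  have hoV : ∀ t, ordZero (sq t).F = (((sq t).r.degree + d : ℕ) : ℕ∞) := fun t => (hshape t (sq t) (hINV t)).2.1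
  have hpV : ∀ t, p < (sq t).r.degree + d := fun t => (hshape t (sq t) (hINV t)).2.2.1
  have heV : ∀ t, Module.finrank K (resVertex (sq t)) = eG := fun t => (hshape t (sq t) (hINV t)).2.2.2.1
  have hpassV : ∀ t, ∀ i, i ∉ S → (sq t).r i = 0 := fun t => (hshape t (sq t) (hINV t)).2.2.2.2.1
  have hdivV : ∀ t, ∀ e ∈ (sq t).F.support, (sq t).r ≤ e := fun t => (hshape t (sq t) (hINV t)).2.2.2.2.2
  have hple : ∀ t, ((p : ℕ) : ℕ∞) ≤ ordAlong Finset.univ (sq t).F := fun t => by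
    rw [ordAlong_univ, hoV t]
    exact_mod_cast (hpV t).le
  have hequi : ∀ t, IsEquimultiplePoint p Finset.univ (Classical.epsilon (Q t (sq t))).1 (Classical.epsilon (Q t (sq t))).2
      (sq t) := fun t => by
    rw [Equimultiple.isEquimultiplePoint_iff_le_ordZero_step, ← hds t, hoV (t + 1)]
    exact_mod_cast (hpV (t + 1)).le
  have hne : ∀ t, (CentreBlowup.step p Finset.univ (Classical.epsilon (Q t (sq t))).1 (Classical.epsilon (Q t (sq t))).2
      (sq t)).F ≠ 0 := fun t h0 => by
    have h := hoV (t + 1)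
    rw [hds t, h0, ordZero_zero] at h
    exact ENat.top_ne_coe _ h
  have hfloorV : ∀ t, ordZero (sq t).F ≠ p := fun t h => by
    rw [hoV t] at h
    have := hpV t
    have h' : (sq t).r.degree + d = p := by exact_mod_cast h
    omega
  have hshadeV : ∀ t, (sq t).shade = (d : ℕ∞) := fun t => by
    rw [BandShade.shade_eq_coe (hoV t)]
    congr 1
    omega
  refine ⟨sq, fun t => (Classical.epsilon (Q t (sq t))).1, fun t => (Classical.epsilon (Q t (sq t))).2, hd0, hINV,
    fun t => ⟨hisoV t, hple t, (Classical.epsilon (Q t (sq t))).1, (Classical.epsilon (Q t (sq t))).2, Finset.mem_univ _,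
      hβℓ t, hequi t, hne t, hds t⟩,
    fun t => ⟨hple t, hβℓ t, hequi t, hne t, hds t⟩, ?_, hfloorV, fun t _ => hshadeV t, fun t _ => heV t, hℓ, hpassV⟩
  rw [hd0]
  have := hdivV 0
  rwa [hd0] at this

/-! ## §2 The support-confined re-presentation from a TT entry, any rank -/

variable [Fact p.Prime] [CharP K p]

/-- **SUPPORT-CONFINED RE-PRESENTATION FROM A TT ENTRY, every prime `p`, every shade `d`, every kernel rank `eG`.**  On a witnessed isolated
above-floor `Step0 p` chain with `x^{r₀} ∣ F₀`, constant shade `d` and `finrank Vtx ≡ eG` from `k₀`, given an entry time `kₑ ≥ k₀` with `c kₑ` clean,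
boundary inside `S` and TT_S: an honest witnessed isolated above-floor `Step0 p` partner `c′` with `x^{r₀′} ∣ F₀′`, `c′ 0 = c kₑ`, shade `d`, rank `eG`,
weights `(c′ t).r = (c (kₑ + t)).r ∘ π_t`, no boundary letter off `S` ever, charts in `S`, TT_S at every time.  (res-dim4-typ-1 g4's
`INV_{p,S}` through `supportInv_refl_rank` / `support_virtual_step_rank`, assembly `support_virtual_chain_rank`.) [OURS]
[cite: CossartJannsenSaito2020, Thm. 3.10(4), Thm. 3.14] [cite: Hauser2010, §§F–G (chart expressions of a point blowup; cleaning)] -/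
theorem support_representation_of_TT {eG : ℕ} {c : ℕ → State K} {j : ℕ → Fin 4} {b : ℕ → Fin 4 → K}
    (hc : ∀ k, IsIsolated p (c k).F ∧ Step0 p (c k) (c (k + 1))) (hw : FreeTail.IsWitnessedChain p c j b)
    (hr0 : ∀ e ∈ (c 0).F.support, (c 0).r ≤ e) (hfloor : ∀ k, ordZero (c k).F ≠ p) {k₀ d : ℕ}
    (hshade : ∀ k, k₀ ≤ k → (c k).shade = (d : ℕ∞)) (he : ∀ k, k₀ ≤ k → Module.finrank K (resVertex (c k)) = eG)
    {kₑ : ℕ} (hke : k₀ ≤ kₑ) (hclean : deletePthPowers p (c kₑ).F = (c kₑ).F) (S : Finset (Fin 4))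
    (hsupp : ∀ i, i ∉ S → (c kₑ).r i = 0) (hTT : ∀ v ∈ resVertex (c kₑ), (∀ i ∈ S, v i = 0) → v = 0) :
    ∃ (c' : ℕ → State K) (j' : ℕ → Fin 4) (b' : ℕ → Fin 4 → K), c' 0 = c kₑ ∧
      (∀ t, ∃ π : Equiv.Perm (Fin 4), (c' t).r = Finsupp.mapDomain (Equiv.symm π) (c (kₑ + t)).r) ∧
      (∀ t, ∀ i, i ∉ S → (c' t).r i = 0) ∧ (∀ t, j' t ∈ S) ∧
      (∀ t, ∀ v ∈ resVertex (c' t), (∀ i ∈ S, v i = 0) → v = 0) ∧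
      (∀ t, IsIsolated p (c' t).F ∧ Step0 p (c' t) (c' (t + 1))) ∧ FreeTail.IsWitnessedChain p c' j' b' ∧
      (∀ e ∈ (c' 0).F.support, (c' 0).r ≤ e) ∧ (∀ t, ordZero (c' t).F ≠ p) ∧
      (∀ t, 0 ≤ t → (c' t).shade = (d : ℕ∞)) ∧ (∀ t, 0 ≤ t → Module.finrank K (resVertex (c' t)) = eG) := by
  have hstep : ∀ k, c (k + 1) = CentreBlowup.step p Finset.univ (j k) (b k) (c k) := fun k => (hw k).2.2.2.2
  have hdivk : ∀ k, ∀ e ∈ (c k).F.support, (c k).r ≤ e := IsolatedBand.isolated_chain_forall_le hc hr0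
  have hord : ∀ m, k₀ ≤ m → ordZero (c m).F = (((c m).r.degree + d : ℕ) : ℕ∞) ∧ p < (c m).r.degree + d := by
    intro m hm
    obtain ⟨o, ho, hpo, -, hod⟩ := chain_shade_nat p hc hfloor hshade hm
    have hro := degree_r_le ho (hdivk m)
    refine ⟨?_, by omega⟩
    rw [ho]; congr 1; omega
  have hentry := SwapTransport.supportInv_refl_rank p S hclean (hdivk kₑ) hsupp (hc kₑ).1 (he kₑ hke) hTT
  obtain ⟨c', j', b', h0, hInv, hc', hw', hr0', hfloor', hshade', he', hletters, hpass⟩ :=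
    support_virtual_chain_rank (K := K) p S eG (d := d) (B₀ := c kₑ)
      (Inv := fun t B => ∃ π : Equiv.Perm (Fin 4), (B.r = Finsupp.mapDomain (Equiv.symm π) (c (kₑ + t)).r ∧
        (∀ i, i ∉ S → B.r i = 0) ∧ ordZero B.F = ordZero (c (kₑ + t)).F ∧ B.shade = (c (kₑ + t)).shade ∧
        (∀ d ∈ B.F.support, B.r ≤ d) ∧ IsIsolated p B.F ∧ Module.finrank K (ResCone.resVertex B) = eG ∧
        (∀ v ∈ ResCone.resVertex B, (∀ i ∈ S, v i = 0) → v = 0) ∧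
        ∃ (Θ e : ℕ → Fin 4 → MvPolynomial (Fin 4) K), (∀ M k, Θ (M + 1) k - Θ M k ∈ originIdeal K ^ (M + 2)) ∧
          ∀ M, (∀ k, constantCoeff (Θ M k) = 0) ∧
            (∀ i, B.r i ≠ 0 → Θ M (π i) = X i * e M i ∧ constantCoeff (e M i) ≠ 0) ∧
            IsUnit (Matrix.det (Matrix.of fun k m => coeff (Finsupp.single m 1) (Θ M k))) ∧
            ∃ U E : MvPolynomial (Fin 4) K, constantCoeff U ≠ 0 ∧ E ∈ originIdeal K ^ M ∧
              B.F = deletePthPowers p (U ^ p * aeval (Θ M) (c (kₑ + t)).F) + E))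
      ⟨1, by rw [Nat.add_zero]; exact hentry⟩
      (fun t B hB => by
        obtain ⟨π, hr, hconfB, hoB, -, hdivB, hisoB, heB, -, -⟩ := hB
        have hkt : k₀ ≤ kₑ + t := by omega
        obtain ⟨ho, hpo⟩ := hord (kₑ + t) hkt
        refine ⟨hisoB, ?_, ?_, heB, hconfB, hdivB⟩
        · rw [hoB, ho, hr, Finsupp.degree_mapDomain]
        · rw [hr, Finsupp.degree_mapDomain]; exact hpo)
      (fun t B hB => by
        obtain ⟨π, hinv⟩ := hB
        have hkt : k₀ ≤ kₑ + t := by omega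
        have hkt1 : k₀ ≤ kₑ + t + 1 := by omega
        obtain ⟨o, ho, hpo, ho2⟩ := chain_band p hc hfloor (kₑ + t)
        obtain ⟨o', ho', hpo', ho2'⟩ := chain_band p hc hfloor (kₑ + t + 1)
        have hsh : (c (kₑ + t + 1)).shade = (c (kₑ + t)).shade := by rw [hshade _ hkt1, hshade _ hkt]
        obtain ⟨ℓ, β, π', hℓ, hβ, hinv'⟩ := SwapTransport.support_virtual_step_rank p S (c (kₑ + t)) (c (kₑ + t + 1)) B π
          (j (kₑ + t)) (b (kₑ + t)) (hw (kₑ + t)).2.1 (hstep (kₑ + t)) (hdivk _) (hdivk _) ⟨o, ho, hpo, ho2⟩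
          ⟨o', ho', hpo', ho2'⟩ hsh (hc (kₑ + t + 1)).1 (he _ hkt1) hinv
        exact ⟨ℓ, β, hℓ, hβ, π', hinv'⟩)
  refine ⟨c', j', b', h0, fun t => ?_, hpass, hletters, fun t => ?_, hc', hw', hr0', hfloor', hshade', he'⟩
  · obtain ⟨π, hr, -⟩ := hInv t
    exact ⟨π, hr⟩
  · obtain ⟨π, -, -, -, -, -, -, -, hTTt, -⟩ := hInv t
    exact hTTt

/-! ## §3 The power-cone dictionary: TT for `univ ∖ {φ}` means «`φ` carries the form» -/

omit [DecidableEq K] [Fact p.Prime] [CharP K p] in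
/-- **TT FOR THREE LETTERS ON A POWER CONE**: if the polar kernel is `ker ℓ` (`w ∈ Vtx ↔ ℓ ⬝ w = 0`), then «no non-zero kernel vector vanishes on
`univ ∖ {φ}`» iff `ℓ φ ≠ 0` — the letter off `S` carries the form. [folklore] -/
theorem tt_erase_iff_apply_ne_zero {V : Submodule K (Fin 4 → K)} {ℓ : Fin 4 → K} (hV : ∀ w, w ∈ V ↔ dotProduct ℓ w = 0)
    (φ : Fin 4) : (∀ v ∈ V, (∀ i ∈ Finset.univ.erase φ, v i = 0) → v = 0) ↔ ℓ φ ≠ 0 := by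
  classical
  constructor
  · intro h hφ
    have hmem : (Pi.single φ 1 : Fin 4 → K) ∈ V := by
      rw [hV, dotProduct_single, hφ, zero_mul]
    have h0 := h _ hmem fun i hi => by
      rw [Pi.single_apply, if_neg (Finset.ne_of_mem_erase hi)]
    have h1 : (Pi.single φ 1 : Fin 4 → K) φ = 0 := by rw [h0]; rfl
    rw [Pi.single_eq_same] at h1
    exact one_ne_zero h1
  · intro hφ v hv hvS
    have hvi : ∀ i, i ≠ φ → v i = 0 := fun i hi => hvS i (Finset.mem_erase.mpr ⟨hi, Finset.mem_univ i⟩)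
    have hdot : dotProduct ℓ v = ℓ φ * v φ := by
      rw [dotProduct, Finset.sum_eq_single φ (fun i _ hi => by rw [hvi i hi, mul_zero])
        (fun h => absurd (Finset.mem_univ φ) h)]
    have hvφ : v φ = 0 := by
      have h := (hV v).mp hv
      rw [hdot] at h
      exact (mul_eq_zero.mp h).resolve_left hφ
    funext i
    by_cases hi : i = φ
    · rw [hi, hvφ]; rfl
    · exact hvi i hi

/-- **THE FREE FORM-CARRIER NORMAL FORM OF A POWER-CONE TAIL** (every prime `p`, every shade `d`, `e_G ≡ 3`): if at some late time
`kₑ ≥ k₀ + 1` a letter `φ` is NOT a boundary letter of `c kₑ` and CARRIES the form (`ℓ_{kₑ} φ ≠ 0` for the linear form of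
`chain_powerCone_package`), then the tail has an HONEST partner `c′` (witnessed isolated above-floor `Step0 p`, `x^{r₀′} ∣ F₀′`, `c′ 0 = c kₑ`,
shade `d`, `e_G ≡ 3`, weights = real weights renamed) in which `φ` is NEVER charted and NEVER a boundary letter (translated freely), and which is
TT for `univ ∖ {φ}` at every time — by `tt_erase_iff_apply_ne_zero` its own form involves `x_φ` at every time.  K25's / K24a's «free letter
carrying L» as a re-presentation fact for all weights. [OURS]
[cite: CossartJannsenSaito2020, Thm. 3.10(4), Thm. 3.14] [cite: Hauser2010, §§F–G (chart expressions of a point blowup; cleaning)] -/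
theorem powerCone_freeCarrier_representation {c : ℕ → State K} {j : ℕ → Fin 4} {b : ℕ → Fin 4 → K}
    (hc : ∀ k, IsIsolated p (c k).F ∧ Step0 p (c k) (c (k + 1))) (hw : FreeTail.IsWitnessedChain p c j b)
    (hr0 : ∀ e ∈ (c 0).F.support, (c 0).r ≤ e) (hfloor : ∀ k, ordZero (c k).F ≠ p) {k₀ d : ℕ}
    (hshade : ∀ k, k₀ ≤ k → (c k).shade = (d : ℕ∞)) (he3 : ∀ k, k₀ ≤ k → Module.finrank K (resVertex (c k)) = 3)
    {ℓ : ℕ → Fin 4 → K} (hℓV : ∀ k, k₀ ≤ k → ∀ w, w ∈ resVertex (c k) ↔ dotProduct (ℓ k) w = 0)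
    {kₑ : ℕ} (hke : k₀ + 1 ≤ kₑ) {φ : Fin 4} (hrφ : (c kₑ).r φ = 0) (hℓφ : ℓ kₑ φ ≠ 0) :
    ∃ (c' : ℕ → State K) (j' : ℕ → Fin 4) (b' : ℕ → Fin 4 → K), c' 0 = c kₑ ∧
      (∀ t, ∃ π : Equiv.Perm (Fin 4), (c' t).r = Finsupp.mapDomain (Equiv.symm π) (c (kₑ + t)).r) ∧
      (∀ t, (c' t).r φ = 0) ∧ (∀ t, j' t ≠ φ) ∧
      (∀ t, ∀ v ∈ resVertex (c' t), (∀ i ∈ Finset.univ.erase φ, v i = 0) → v = 0) ∧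
      (∀ t, IsIsolated p (c' t).F ∧ Step0 p (c' t) (c' (t + 1))) ∧ FreeTail.IsWitnessedChain p c' j' b' ∧
      (∀ e ∈ (c' 0).F.support, (c' 0).r ≤ e) ∧ (∀ t, ordZero (c' t).F ≠ p) ∧
      (∀ t, 0 ≤ t → (c' t).shade = (d : ℕ∞)) ∧ (∀ t, 0 ≤ t → Module.finrank K (resVertex (c' t)) = 3) := by
  have hstep : ∀ k, c (k + 1) = CentreBlowup.step p Finset.univ (j k) (b k) (c k) := fun k => (hw k).2.2.2.2
  -- the entry: `c kₑ` is clean (it is a step), its boundary avoids `φ`, and TT_{univ ∖ {φ}} ⟸ `ℓ φ ≠ 0`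
  obtain ⟨k', rfl⟩ : ∃ k', kₑ = k' + 1 := ⟨kₑ - 1, by omega⟩
  have hclean : deletePthPowers p (c (k' + 1)).F = (c (k' + 1)).F := by
    rw [hstep k']
    exact FrameChange.deletePthPowers_step_F p Finset.univ (j k') (b k') (c k')
  have hsupp : ∀ i, i ∉ Finset.univ.erase φ → (c (k' + 1)).r i = 0 := by
    intro i hi
    have hiφ : i = φ := by
      by_contra h
      exact hi (Finset.mem_erase.mpr ⟨h, Finset.mem_univ i⟩)
    rw [hiφ, hrφ]
  have hTT : ∀ v ∈ resVertex (c (k' + 1)), (∀ i ∈ Finset.univ.erase φ, v i = 0) → v = 0 :=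
    (tt_erase_iff_apply_ne_zero (hℓV (k' + 1) (by omega)) φ).mpr hℓφ
  obtain ⟨c', j', b', h0, hperm, hconf, hchart, hTT', hc', hw', hr0', hfloor', hshade', he'⟩ :=
    support_representation_of_TT p hc hw hr0 hfloor hshade he3 (show k₀ ≤ k' + 1 by omega) hclean (Finset.univ.erase φ) hsupp hTT
  refine ⟨c', j', b', h0, hperm, fun t => hconf t φ (Finset.notMem_erase φ _), fun t h => ?_, hTT', hc', hw', hr0', hfloor',
    hshade', he'⟩
  exact Finset.notMem_erase φ Finset.univ (h ▸ hchart t)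

end ResCone

end Summit.ResolutionOfSingularities.ResolutionOfSingularities.Theorems.PIDim4

end
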